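import Literature.Probability.Percolation.KSTPeriodicArmDuality

/-!
# Stub `kstArmDuality` of line `finite-size-envelope`, crux `CriticalPathRSW` (stmt-CriticalPhenomena-10267)

The arm / dual-bridge duality `KSTPeriodic.ArmDuality` of [KohlerSchindlerTassion2023, §1
'Duality' and footnote 3]: for a lattice configuration `ω`, the rectangle
`R = [x₁, x₂] × [y₁, y₂]` with targets `[u₁, u₂] × {y₂}`, `[u₁, u₂] × {y₁}` (`x₁ < u₁ < u₂ < x₂`,
`y₁ < y₂`), exactly one of "an open path of `R` joins the targets" / "the dual configuration of
`ω ∩ E(R)` joins the left group of faces to the right group through allowed faces" holds.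

This file is a wrapper: the mathematics is the Literature theorem
`Literature.Probability.Percolation.KSTPeriodic.armDuality`
(`Literature/Probability/Percolation/KSTPeriodicArmDuality.lean`; planar tools in
`KSTPeriodicArmDualityPlanar.lean`): "not both" by the transposed discrete Jordan curve theorem
applied to the target-to-target walk extended by one vertical edge at each end, "at least one" by
the transposed parity lemma for the colouring "on the row below `R`, or joined inside `R` to the
lower target".
-/

namespace Summit.CriticalPhenomena.CardyFormulaZ2.Cruxes.CriticalPathRSW.FiniteSizeEnvelope

open Set MeasureTheory Filter Topology
open Literature.Probability.LatticeModels Literature.Probability.Percolation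

/-- **Stub `stub_kstArmDuality`**: the arm / dual-bridge duality
[KohlerSchindlerTassion2023, §1 'Duality', footnote 3], i.e. the named statement
`KSTPeriodic.ArmDuality`, from the Literature theorem `KSTPeriodic.armDuality`. -/
theorem stub_kstArmDuality : KSTPeriodic.ArmDuality :=
  KSTPeriodic.armDuality

end Summit.CriticalPhenomena.CardyFormulaZ2.Cruxes.CriticalPathRSW.FiniteSizeEnvelope
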